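import Mathlib.Analysis.SpecialFunctions.Exp
import Mathlib.Tactic
import HarnessLib

/-!
# FAR beyond trees: the deterministic core of the SURPLUS fixed-set FAR inequality —
# `m E²(E−3)(m−E)^{m−3} ≤ 4(m−2)^{m−2}` whenever `4m ≤ E²`, `0 ≤ E < m`, `m ≥ 5`

builds on p205010 (kernel theorem, internal audit signed; external expert review pending)

Support file (`--supports stmt-CriticalPhenomena-4575`), seat `prim-cert-1` (gen 37); memo `prim-cert-1/FROM-prim-cert-1-g37-SURPLUS-FAR.md`.
Pure real algebra plus `Real.exp`; it is the last step of `Quant.CountDP.surplus_far_two` (`…QuantSurplusFAR.lean`): after Cantelli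
(`η·E N ≤ 4`) and the Chernoff–AM–GM bound `P(S_m ≤ 2) ≤ (E/2)²(Q/(m−2))^{m−2}` (`η·E N > 4`, `Q = m − E`), the surplus inequality
`P(S_m ≤ 2)(E − 3) ≤ 1 − η` reduces (via `1 − η ≥ Q/m` and `E² ≥ 4m`) to the inequality of the title.

* `Quant.CountDP.surplus_core_of_table` — one table row: `3 ≤ a`, `a² ≤ 4m`, `m³(m−3)(m−a)^{m−3} ≤ 4(m−2)^{m−2}` give the inequality for
  every admissible `E` (monotone decoupling `E ≥ a`, `E²(E−3) ≤ m²(m−3)`, `(m−E)^{m−3} ≤ (m−a)^{m−3}`).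
* `Quant.CountDP.surplus_core_small` — `5 ≤ m ≤ 35`: the row `a₀(m) = ⌊200√m⌋/100` of each `m`, checked by `norm_num` (exact rationals;
  worst ratio `0.98` at `m = 8`).
* `Quant.CountDP.surplus_core_large` — `m ≥ 36` (then `E ≥ 12`): with `t = (E−2)/(m−2)`, `m − E = (m−2)(1−t)`,
  `(1−t)^{m−3} ≤ e^{−t(m−3)} ≤ 720/(t(m−3))⁶` (`Real.one_sub_le_exp_neg`, `Real.pow_div_factorial_le_exp`), and then
  `180 m (m−2)⁵ E²(E−3) ≤ (E−2)⁶(m−3)⁶` from `m ≤ (12/11)(m−3)`, `m−2 ≤ (34/33)(m−3)`, `E−2 ≥ 5E/6`, `E³ ≥ 1728`.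
* **`Quant.CountDP.surplus_core`** — the inequality for all `m ≥ 5`.
Numerically the worst ratio of the two sides on the admissible region is `0.38` (`m = 5`, `E = 2√5`); seat folder `work/py/star2check4.py`,
`dtable.py`.  No definitions, no sorries, standard axioms.  Elementary [this work].
-/

noncomputable section

namespace Summit.CriticalPhenomena.PercolationContinuityZ3.Theorems

namespace Quant

namespace CountDP

/-! ### The table rows (`5 ≤ m ≤ 35`) -/

/-- One table row: if `3 ≤ a`, `a² ≤ 4m` and `m³(m−3)(m−a)^{m−3} ≤ 4(m−2)^{m−2}`, then `m E²(E−3)(m−E)^{m−3} ≤ 4(m−2)^{m−2}` for every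
`0 ≤ E ≤ m` with `4m ≤ E²` (monotone decoupling: `E ≥ a`, `E²(E−3) ≤ m²(m−3)`, `(m−E)^{m−3} ≤ (m−a)^{m−3}`). [this work] -/
theorem surplus_core_of_table (m : ℕ) (a : ℝ) (h3 : 3 ≤ a) (ha : a ^ 2 ≤ 4 * (m : ℝ))
    (hnum : (m : ℝ) ^ 3 * ((m : ℝ) - 3) * ((m : ℝ) - a) ^ (m - 3) ≤ 4 * ((m : ℝ) - 2) ^ (m - 2))
    (E : ℝ) (hE0 : 0 ≤ E) (hEm : E ≤ m) (hE2 : 4 * (m : ℝ) ≤ E ^ 2) :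
    (m : ℝ) * E ^ 2 * (E - 3) * ((m : ℝ) - E) ^ (m - 3) ≤ 4 * ((m : ℝ) - 2) ^ (m - 2) := by
  have haE : a ≤ E := by
    by_contra h
    push Not at h
    have : E * E < a * a := mul_self_lt_mul_self hE0 h
    nlinarith
  have h1 : E ^ 2 * (E - 3) ≤ (m : ℝ) ^ 2 * ((m : ℝ) - 3) :=
    mul_le_mul (pow_le_pow_left₀ hE0 hEm 2) (by linarith) (by linarith) (pow_nonneg (Nat.cast_nonneg m) 2)
  have h2 : ((m : ℝ) - E) ^ (m - 3) ≤ ((m : ℝ) - a) ^ (m - 3) := pow_le_pow_left₀ (by linarith) (by linarith) _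
  calc (m : ℝ) * E ^ 2 * (E - 3) * ((m : ℝ) - E) ^ (m - 3)
      = (m : ℝ) * ((E ^ 2 * (E - 3)) * ((m : ℝ) - E) ^ (m - 3)) := by ring
    _ ≤ (m : ℝ) * (((m : ℝ) ^ 2 * ((m : ℝ) - 3)) * ((m : ℝ) - a) ^ (m - 3)) :=
        mul_le_mul_of_nonneg_left (mul_le_mul h1 h2 (pow_nonneg (by linarith) _)
          (mul_nonneg (sq_nonneg _) (by linarith))) (Nat.cast_nonneg m)
    _ = (m : ℝ) ^ 3 * ((m : ℝ) - 3) * ((m : ℝ) - a) ^ (m - 3) := by ring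
    _ ≤ 4 * ((m : ℝ) - 2) ^ (m - 2) := hnum

/-- The deterministic inequality for `5 ≤ m ≤ 35`: one rational evaluation per `m` (table `a₀(m) = ⌊200√m⌋/100`). [this work] -/
theorem surplus_core_small (m : ℕ) (hm5 : 5 ≤ m) (hm35 : m ≤ 35) (E : ℝ) (hE0 : 0 ≤ E) (hEm : E ≤ m)
    (hE2 : 4 * (m : ℝ) ≤ E ^ 2) :
    (m : ℝ) * E ^ 2 * (E - 3) * ((m : ℝ) - E) ^ (m - 3) ≤ 4 * ((m : ℝ) - 2) ^ (m - 2) := by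
  interval_cases m
  · exact surplus_core_of_table 5 (447/100) (by norm_num) (by norm_num) (by norm_num) E hE0 hEm hE2
  · exact surplus_core_of_table 6 (489/100) (by norm_num) (by norm_num) (by norm_num) E hE0 hEm hE2
  · exact surplus_core_of_table 7 (529/100) (by norm_num) (by norm_num) (by norm_num) E hE0 hEm hE2
  · exact surplus_core_of_table 8 (113/20) (by norm_num) (by norm_num) (by norm_num) E hE0 hEm hE2
  · exact surplus_core_of_table 9 6 (by norm_num) (by norm_num) (by norm_num) E hE0 hEm hE2
  · exact surplus_core_of_table 10 (158/25) (by norm_num) (by norm_num) (by norm_num) E hE0 hEm hE2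
  · exact surplus_core_of_table 11 (663/100) (by norm_num) (by norm_num) (by norm_num) E hE0 hEm hE2
  · exact surplus_core_of_table 12 (173/25) (by norm_num) (by norm_num) (by norm_num) E hE0 hEm hE2
  · exact surplus_core_of_table 13 (721/100) (by norm_num) (by norm_num) (by norm_num) E hE0 hEm hE2
  · exact surplus_core_of_table 14 (187/25) (by norm_num) (by norm_num) (by norm_num) E hE0 hEm hE2
  · exact surplus_core_of_table 15 (387/50) (by norm_num) (by norm_num) (by norm_num) E hE0 hEm hE2
  · exact surplus_core_of_table 16 8 (by norm_num) (by norm_num) (by norm_num) E hE0 hEm hE2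
  · exact surplus_core_of_table 17 (206/25) (by norm_num) (by norm_num) (by norm_num) E hE0 hEm hE2
  · exact surplus_core_of_table 18 (212/25) (by norm_num) (by norm_num) (by norm_num) E hE0 hEm hE2
  · exact surplus_core_of_table 19 (871/100) (by norm_num) (by norm_num) (by norm_num) E hE0 hEm hE2
  · exact surplus_core_of_table 20 (447/50) (by norm_num) (by norm_num) (by norm_num) E hE0 hEm hE2
  · exact surplus_core_of_table 21 (229/25) (by norm_num) (by norm_num) (by norm_num) E hE0 hEm hE2
  · exact surplus_core_of_table 22 (469/50) (by norm_num) (by norm_num) (by norm_num) E hE0 hEm hE2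
  · exact surplus_core_of_table 23 (959/100) (by norm_num) (by norm_num) (by norm_num) E hE0 hEm hE2
  · exact surplus_core_of_table 24 (979/100) (by norm_num) (by norm_num) (by norm_num) E hE0 hEm hE2
  · exact surplus_core_of_table 25 10 (by norm_num) (by norm_num) (by norm_num) E hE0 hEm hE2
  · exact surplus_core_of_table 26 (1019/100) (by norm_num) (by norm_num) (by norm_num) E hE0 hEm hE2
  · exact surplus_core_of_table 27 (1039/100) (by norm_num) (by norm_num) (by norm_num) E hE0 hEm hE2
  · exact surplus_core_of_table 28 (529/50) (by norm_num) (by norm_num) (by norm_num) E hE0 hEm hE2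
  · exact surplus_core_of_table 29 (1077/100) (by norm_num) (by norm_num) (by norm_num) E hE0 hEm hE2
  · exact surplus_core_of_table 30 (219/20) (by norm_num) (by norm_num) (by norm_num) E hE0 hEm hE2
  · exact surplus_core_of_table 31 (1113/100) (by norm_num) (by norm_num) (by norm_num) E hE0 hEm hE2
  · exact surplus_core_of_table 32 (1131/100) (by norm_num) (by norm_num) (by norm_num) E hE0 hEm hE2
  · exact surplus_core_of_table 33 (287/25) (by norm_num) (by norm_num) (by norm_num) E hE0 hEm hE2
  · exact surplus_core_of_table 34 (583/50) (by norm_num) (by norm_num) (by norm_num) E hE0 hEm hE2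
  · exact surplus_core_of_table 35 (1183/100) (by norm_num) (by norm_num) (by norm_num) E hE0 hEm hE2

/-- The deterministic inequality for `m ≥ 36` (then `E ≥ 12`): with `t = (E−2)/(m−2)`, `m − E = (m−2)(1−t)` and
`(1−t)^{m−3} ≤ e^{−t(m−3)} ≤ 720/(t(m−3))⁶`, after which `180 m (m−2)⁵ E²(E−3) ≤ (E−2)⁶ (m−3)⁶` is elementary. [this work] -/
theorem surplus_core_large (m : ℕ) (hm : 36 ≤ m) (E : ℝ) (hE0 : 0 ≤ E) (hEm : E < m) (hE2 : 4 * (m : ℝ) ≤ E ^ 2) :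
    (m : ℝ) * E ^ 2 * (E - 3) * ((m : ℝ) - E) ^ (m - 3) ≤ 4 * ((m : ℝ) - 2) ^ (m - 2) := by
  obtain ⟨n, rfl⟩ : ∃ n, m = n + 3 := ⟨m - 3, by omega⟩
  have hn33 : (33 : ℝ) ≤ n := by exact_mod_cast (show 33 ≤ n by omega)
  simp only [Nat.add_sub_cancel, show n + 3 - 2 = n + 1 by omega]
  push_cast at hEm hE2 ⊢
  -- `E ≥ 12`
  have hE12 : 12 ≤ E := by
    by_contra h
    push Not at h
    have : E * E < 12 * 12 := mul_self_lt_mul_self hE0 h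
    nlinarith
  set A : ℝ := (n : ℝ) + 1 with hAdef   -- `A = m − 2`
  have hA0 : 0 < A := by rw [hAdef]; linarith
  have hmA : ((n : ℝ) + 3) - 2 = A := by rw [hAdef]; ring
  set t : ℝ := (E - 2) / A with htdef
  have ht0 : 0 < t := div_pos (by linarith) hA0
  have ht1 : t ≤ 1 := by rw [htdef, div_le_one hA0, hAdef]; linarith
  have hQ : ((n : ℝ) + 3) - E = A * (1 - t) := by rw [htdef]; field_simp; ring
  -- `(1 − t)^n ≤ exp(−t)^n = exp(−(t n))`
  have h1t : (1 - t) ^ n ≤ Real.exp (-(t * n)) := by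
    calc (1 - t) ^ n ≤ (Real.exp (-t)) ^ n := pow_le_pow_left₀ (by linarith) (Real.one_sub_le_exp_neg t) n
      _ = Real.exp (-(t * n)) := by rw [← Real.exp_nat_mul]; ring_nf
  -- `exp(−x) ≤ 720/x⁶`
  set x : ℝ := t * n with hxdef
  have hx0 : 0 < x := mul_pos ht0 (by linarith)
  have hexp : Real.exp (-x) ≤ 720 / x ^ 6 := by
    have h := Real.pow_div_factorial_le_exp x hx0.le 6
    have h6 : ((Nat.factorial 6 : ℕ) : ℝ) = 720 := by norm_num [Nat.factorial]
    rw [h6] at h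
    rw [Real.exp_neg, inv_eq_one_div, div_le_div_iff₀ (Real.exp_pos x) (pow_pos hx0 6)]
    have := (div_le_iff₀ (by norm_num : (0:ℝ) < 720)).1 h
    linarith
  have hpow : (1 - t) ^ n ≤ 720 / x ^ 6 := h1t.trans hexp
  -- reduce to `m E²(E−3)(1−t)^n ≤ 4A` and then to the polynomial inequality
  rw [hmA, hQ, mul_pow, pow_succ]
  have hAn : 0 < A ^ n := pow_pos hA0 n
  suffices hsuff : ((n : ℝ) + 3) * E ^ 2 * (E - 3) * (1 - t) ^ n ≤ 4 * A by
    calc ((n : ℝ) + 3) * E ^ 2 * (E - 3) * (A ^ n * (1 - t) ^ n)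
        = (((n : ℝ) + 3) * E ^ 2 * (E - 3) * (1 - t) ^ n) * A ^ n := by ring
      _ ≤ (4 * A) * A ^ n := mul_le_mul_of_nonneg_right hsuff hAn.le
      _ = 4 * (A ^ n * A) := by ring
  have hpre : 0 ≤ ((n : ℝ) + 3) * E ^ 2 * (E - 3) := by
    have : 0 ≤ E - 3 := by linarith
    positivity
  calc ((n : ℝ) + 3) * E ^ 2 * (E - 3) * (1 - t) ^ n
      ≤ ((n : ℝ) + 3) * E ^ 2 * (E - 3) * (720 / x ^ 6) := mul_le_mul_of_nonneg_left hpow hpre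
    _ ≤ 4 * A := by
        rw [← mul_div_assoc, div_le_iff₀ (pow_pos hx0 6), hxdef, htdef]
        -- goal: `(n+3) E²(E−3)·720 ≤ 4A·((E−2)/A · n)^6`
        rw [mul_pow, div_pow]
        -- polynomial facts
        have hE2' : (5 / 6 * E) ≤ E - 2 := by linarith
        have hE26 : (5 / 6 * E) ^ 6 ≤ (E - 2) ^ 6 := pow_le_pow_left₀ (by linarith) hE2' 6
        have hE3 : E ^ 2 * (E - 3) ≤ E ^ 3 := by nlinarith [sq_nonneg E]
        have hn1 : (n : ℝ) + 3 ≤ 12 / 11 * n := by linarith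
        have hn2 : A ≤ 34 / 33 * n := by rw [hAdef]; linarith
        have hn0 : (0 : ℝ) < n := by linarith
        have hA5 : A ^ 5 ≤ (34 / 33 * n) ^ 5 := pow_le_pow_left₀ hA0.le hn2 5
        have hE1728 : (1728 : ℝ) ≤ E ^ 3 := by nlinarith [sq_nonneg E, mul_self_nonneg (E - 12)]
        -- `4A·(E−2)^6 n^6/A^6 = 4 (E−2)^6 n^6 / A^5`
        have eA : 4 * A * ((E - 2) ^ 6 / A ^ 6 * (n : ℝ) ^ 6) = 4 * (E - 2) ^ 6 * (n : ℝ) ^ 6 / A ^ 5 := by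
          field_simp
        rw [eA, le_div_iff₀ (pow_pos hA0 5)]
        -- now: `(n+3) E²(E−3) 720 · A^5 ≤ 4 (E−2)^6 n^6`
        calc ((n : ℝ) + 3) * E ^ 2 * (E - 3) * 720 * A ^ 5
            ≤ (12 / 11 * n) * E ^ 3 * 720 * (34 / 33 * n) ^ 5 := by
              have hE3' : 0 ≤ E ^ 2 * (E - 3) := mul_nonneg (sq_nonneg E) (by linarith)
              have h1 : ((n : ℝ) + 3) * E ^ 2 * (E - 3) ≤ (12 / 11 * n) * E ^ 3 :=
                calc ((n : ℝ) + 3) * E ^ 2 * (E - 3) = ((n : ℝ) + 3) * (E ^ 2 * (E - 3)) := by ring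
                  _ ≤ (12 / 11 * n) * E ^ 3 := mul_le_mul hn1 hE3 hE3' (by positivity)
              have h2 : ((n : ℝ) + 3) * E ^ 2 * (E - 3) * 720 ≤ (12 / 11 * n) * E ^ 3 * 720 := by linarith
              exact mul_le_mul h2 hA5 (pow_nonneg hA0.le 5) (by positivity)
          _ = (720 * 12 / 11 * (34 / 33) ^ 5) * (E ^ 3 * (n : ℝ) ^ 6) := by ring
          _ ≤ (4 * (5 / 6) ^ 6 * 1728) * (E ^ 3 * (n : ℝ) ^ 6) := by
              refine mul_le_mul_of_nonneg_right (by norm_num) (by positivity)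
          _ = 4 * ((5 / 6) ^ 6 * E ^ 3 * 1728) * (n : ℝ) ^ 6 := by ring
          _ ≤ 4 * ((5 / 6 * E) ^ 6) * (n : ℝ) ^ 6 := by
              have : (5 / 6 : ℝ) ^ 6 * E ^ 3 * 1728 ≤ (5 / 6 * E) ^ 6 := by
                rw [mul_pow]
                have e : ((5:ℝ) / 6) ^ 6 * E ^ 6 = (5 / 6) ^ 6 * E ^ 3 * E ^ 3 := by ring
                rw [e]
                exact mul_le_mul_of_nonneg_left hE1728 (by positivity)
              nlinarith [pow_nonneg hn0.le 6]
          _ ≤ 4 * (E - 2) ^ 6 * (n : ℝ) ^ 6 := by nlinarith [pow_nonneg hn0.le 6]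

/-- **The deterministic inequality**: for `m ≥ 5`, `0 ≤ E < m` and `4m ≤ E²`:  `m E²(E−3)(m−E)^{m−3} ≤ 4(m−2)^{m−2}`. [this work] -/
theorem surplus_core (m : ℕ) (hm : 5 ≤ m) (E : ℝ) (hE0 : 0 ≤ E) (hEm : E < m) (hE2 : 4 * (m : ℝ) ≤ E ^ 2) :
    (m : ℝ) * E ^ 2 * (E - 3) * ((m : ℝ) - E) ^ (m - 3) ≤ 4 * ((m : ℝ) - 2) ^ (m - 2) := by
  rcases Nat.lt_or_ge m 36 with h | h
  · exact surplus_core_small m hm (by omega) E hE0 hEm.le hE2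
  · exact surplus_core_large m h E hE0 hEm hE2

end CountDP

end Quant

end Summit.CriticalPhenomena.PercolationContinuityZ3.Theorems

end
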